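import Mathlib
import Literature.Analysis.ODE.LipschitzFlow
import Literature.Analysis.ODE.FlowWithin
import Literature.Analysis.ODE.LiouvilleFormula
import HarnessLib

/-!
# Liouville's theorem for the global flow of a `C¹`, globally Lipschitz, divergence-free field:
# the time-`T` maps preserve Lebesgue measure
  (tools for route `RotatedEulerWindow`, item `DecayFluxRecurrence`, stmt-NavierStokesRegularity-19348,
  and route `VortexLineClock`, item `FluxCapacityRecurrence`, stmt-NavierStokesRegularity-11276)

For `g : E → E` of class `C¹`, globally `K`-Lipschitz, on a finite-dimensional real normed space,
the tree's global flow `Ψ_T = Literature.Analysis.ODE.lipschitzFlow` (`Ψ q T` = the integral curve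
through `q` at time `T`) has, for `T ≥ 0`:

* `DecayFlux.exists_hasFDerivAt_flow_det_eq_exp` — the time-`T` map is differentiable at every
  point, with a derivative `J` solving the variational equation, and `det J = exp (∫ div g)` along the
  trajectory; in particular `det J = 1` when `div g = tr Dg ≡ 0`
  (`DecayFlux.exists_hasFDerivAt_flow_det_eq_one`). Ingredients: the tree's variational equation
  within a convex set (`IsSolutionFamily.exists_linearization` / `.hasFDerivWithinAt`, Lang IV §1
  Thm 1.14) and the Abel–Liouville–Jacobi formula (`det_eq_exp_mul_of_trace_eq`).
* `DecayFlux.addHaar_image_flow_eq` — **Liouville's theorem**: `μ (Ψ_T '' s) = μ s` for every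
  measurable `s` and every additive Haar measure `μ` (Mathlib's area formula
  `lintegral_abs_det_fderiv_eq_addHaar_image`, the time-`T` map being injective).
* `DecayFlux.measurePreserving_flow` — the time-`T` map is `MeasurePreserving μ μ` (surjectivity:
  `Ψ_T ∘ Ψ_{-T} = id`).

References: V. I. Arnold, *Mathematical Methods of Classical Mechanics*, §16 (Liouville's theorem);
P. Hartman, *ODE*, Ch. V Thm 3.1, Ch. IV Thm 1.2; S. Lang, *Differential and Riemannian Manifolds*
(1995), Ch. IV §1.

HONEST FRAMING: classical ODE infrastructure (Liouville's theorem) for the vortex-line flows of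
HYPOTHETICAL self-similar profiles; nothing here bears on the regularity problem itself.
-/

noncomputable section

set_option linter.dupNamespace false

namespace Summit.NavierStokesRegularity.NavierStokesRegularity.Theorems

open Set Function Filter Topology MeasureTheory Metric
open scoped NNReal ContDiff
open Literature.Analysis.ODE

namespace DecayFlux

variable {E : Type*} [NormedAddCommGroup E] [NormedSpace ℝ E] [FiniteDimensional ℝ E]

/-- The time-`T` map of the global flow of a `C¹` globally Lipschitz field is continuous (indeed
`C¹`, `contDiff_lipschitzFlow`). -/
theorem continuous_flow_slice {g : E → E} {K : ℝ≥0} (hK : LipschitzWith K g) (hg : ContDiff ℝ 1 g)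
    (T : ℝ) : Continuous fun q => lipschitzFlow hK q T := by
  have h := contDiff_lipschitzFlow hg le_rfl hK
  have h2 : ContDiff ℝ 1 fun q : E => (q, T) := contDiff_id.prodMk contDiff_const
  exact (h.comp h2).continuous

/-- The time-`T` map of the global flow is injective (`Ψ_{-T} ∘ Ψ_T = id`). -/
theorem injective_flow_slice {g : E → E} {K : ℝ≥0} (hK : LipschitzWith K g) (T : ℝ) :
    Injective fun q => lipschitzFlow hK q T := by
  intro a b hab
  have h := congrArg (fun q => lipschitzFlow hK q (-T)) hab
  simpa only [lipschitzFlow_neg_lipschitzFlow] using h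

/-- The time-`T` map of the global flow is surjective (`Ψ_T ∘ Ψ_{-T} = id`). -/
theorem surjective_flow_slice {g : E → E} {K : ℝ≥0} (hK : LipschitzWith K g) (T : ℝ) :
    Surjective fun q => lipschitzFlow hK q T := by
  intro b
  refine ⟨lipschitzFlow hK b (-T), ?_⟩
  have h := lipschitzFlow_neg_lipschitzFlow hK b (-T)
  simpa only [neg_neg] using h

/-- Iterating the time-`T` map `n` times is the time-`nT` map (group law `lipschitzFlow_add`). -/
theorem iterate_flow_slice {g : E → E} {K : ℝ≥0} (hK : LipschitzWith K g) (T : ℝ) (n : ℕ)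
    (q : E) : (fun q => lipschitzFlow hK q T)^[n] q = lipschitzFlow hK q (n * T) := by
  induction n with
  | zero => simp
  | succ n ih =>
    rw [Function.iterate_succ_apply', ih, ← lipschitzFlow_add]
    congr 1
    push_cast
    ring

variable [CompleteSpace E]

/-- **The variational equation and Liouville's formula along the global flow.** For `g ∈ C¹`
globally Lipschitz and `T ≥ 0`, the time-`T` map `q ↦ Ψ q T` has at every `x` a derivative `J`
with `det J = exp (d T)` whenever `tr Dg ≡ d` is constant (Lang IV §1 Thm 1.14 + Abel–Liouville–
Jacobi). [folklore] -/
theorem exists_hasFDerivAt_flow_det_eq_exp {g : E → E} {K : ℝ≥0} (hK : LipschitzWith K g)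
    (hg : ContDiff ℝ 1 g) {d : ℝ} (hdiv : ∀ y, LinearMap.trace ℝ E (fderiv ℝ g y : E →ₗ[ℝ] E) = d)
    {T : ℝ} (hT : 0 ≤ T) (x : E) :
    ∃ J : E →L[ℝ] E, HasFDerivAt (fun q => lipschitzFlow hK q T) J x ∧ J.det = Real.exp (d * T) := by
  set u : E → ℝ → E := lipschitzFlow hK with hu
  have hfam : IsSolutionFamily g univ univ T u :=
    ⟨fun y _ => lipschitzFlow_zero hK y,
      fun y _ τ _ => (hasDerivAt_lipschitzFlow hK y τ).hasDerivWithinAt, fun _ _ _ _ => mem_univ _⟩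
  obtain ⟨J, hJ0, hJ⟩ := hfam.exists_linearization hT uniqueDiffOn_univ hg.contDiffOn
  have hderiv : HasFDerivWithinAt (fun y' => u y' T) (J x T) univ x :=
    hfam.hasFDerivWithinAt hT convex_univ uniqueDiffOn_univ hg.contDiffOn (mem_univ x)
      (hJ0 x (mem_univ x)) (hJ x (mem_univ x)) ⟨hT, le_rfl⟩
  refine ⟨J x T, hderiv.hasFDerivAt univ_mem, ?_⟩
  -- the coefficient `A t = Dg(Ψ_t x)`
  set A : ℝ → E →L[ℝ] E := fun t => fderiv ℝ g (u x t) with hA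
  have hJ' : ∀ t ∈ Icc 0 T, HasDerivWithinAt (J x) ((A t).comp (J x t)) (Icc 0 T) t := by
    intro t ht
    have h := hJ x (mem_univ x) t ht
    rwa [fderivWithin_univ] at h
  have hAcont : ContinuousOn A (Icc 0 T) :=
    ((hg.continuous_fderiv one_ne_zero).comp (continuous_lipschitzFlow hK x)).continuousOn
  have hJc : ∀ v, ContinuousOn (fun s => J x s v) (Icc 0 T) := fun v t ht =>
    ((hJ' t ht).continuousWithinAt).clm_apply continuousWithinAt_const
  have hJv : ∀ v, ∀ t ∈ Ico 0 T, HasDerivWithinAt (fun s => J x s v) (A t (J x t v)) (Ici t) t := by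
    intro v t ht
    have hJt : HasDerivWithinAt (J x) ((A t).comp (J x t)) (Ici t) t :=
      (hJ' t (Ico_subset_Icc_self ht)).mono_of_mem_nhdsWithin
        (mem_of_superset (Icc_mem_nhdsGE ht.2) (Icc_subset_Icc ht.1 le_rfl))
    have h := hJt.clm_apply (hasDerivWithinAt_const t (Ici t) v)
    simpa using h
  have h1 : J x 0 = ContinuousLinearMap.id ℝ E := by
    rw [hJ0 x (mem_univ x)]; rfl
  exact det_eq_exp_mul_of_trace_eq hT hAcont hJc hJv h1 (d := d) (fun s _ => hdiv _) T ⟨hT, le_rfl⟩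

/-- **`det DΨ_T = 1` for a divergence-free field**: for `g ∈ C¹` globally Lipschitz with
`tr Dg ≡ 0` and `T ≥ 0`, the time-`T` map has at every point a derivative of determinant `1`.
[folklore] -/
theorem exists_hasFDerivAt_flow_det_eq_one {g : E → E} {K : ℝ≥0} (hK : LipschitzWith K g)
    (hg : ContDiff ℝ 1 g) (hdiv : ∀ y, LinearMap.trace ℝ E (fderiv ℝ g y : E →ₗ[ℝ] E) = 0)
    {T : ℝ} (hT : 0 ≤ T) (x : E) :
    ∃ J : E →L[ℝ] E, HasFDerivAt (fun q => lipschitzFlow hK q T) J x ∧ J.det = 1 := by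
  obtain ⟨J, hJ, hdet⟩ := exists_hasFDerivAt_flow_det_eq_exp hK hg hdiv hT x
  exact ⟨J, hJ, by rw [hdet, zero_mul, Real.exp_zero]⟩

variable [MeasurableSpace E] [BorelSpace E]

/-- **Liouville's theorem** for the global flow of a `C¹`, globally Lipschitz, divergence-free
field: the time-`T` map (`T ≥ 0`) preserves the volume of every measurable set, for any additive
Haar measure (area formula with `|det DΨ_T| = 1`, `Ψ_T` injective). [folklore] -/
theorem addHaar_image_flow_eq (μ : Measure E) [μ.IsAddHaarMeasure] {g : E → E} {K : ℝ≥0}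
    (hK : LipschitzWith K g) (hg : ContDiff ℝ 1 g)
    (hdiv : ∀ y, LinearMap.trace ℝ E (fderiv ℝ g y : E →ₗ[ℝ] E) = 0) {T : ℝ} (hT : 0 ≤ T)
    {s : Set E} (hs : MeasurableSet s) :
    μ ((fun q => lipschitzFlow hK q T) '' s) = μ s := by
  choose J hJ hdet using fun x => exists_hasFDerivAt_flow_det_eq_one hK hg hdiv hT x
  have h := lintegral_abs_det_fderiv_eq_addHaar_image μ hs
    (fun x _ => (hJ x).hasFDerivWithinAt) (injective_flow_slice hK T).injOn
  rw [← h]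
  simp only [hdet, abs_one, ENNReal.ofReal_one, setLIntegral_one]

/-- **The time-`T` maps of the flow of a `C¹`, globally Lipschitz, divergence-free field are
measure preserving** (`T ≥ 0`; any additive Haar measure): Liouville's theorem plus surjectivity.
[folklore] -/
theorem measurePreserving_flow (μ : Measure E) [μ.IsAddHaarMeasure] {g : E → E} {K : ℝ≥0}
    (hK : LipschitzWith K g) (hg : ContDiff ℝ 1 g)
    (hdiv : ∀ y, LinearMap.trace ℝ E (fderiv ℝ g y : E →ₗ[ℝ] E) = 0) {T : ℝ} (hT : 0 ≤ T) :
    MeasurePreserving (fun q => lipschitzFlow hK q T) μ μ := by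
  have hmeas : Measurable fun q => lipschitzFlow hK q T := (continuous_flow_slice hK hg T).measurable
  refine ⟨hmeas, Measure.ext fun B hB => ?_⟩
  rw [Measure.map_apply hmeas hB]
  have h := addHaar_image_flow_eq μ hK hg hdiv hT (hmeas hB)
  rw [image_preimage_eq B (surjective_flow_slice hK T)] at h
  exact h.symm

end DecayFlux

end Summit.NavierStokesRegularity.NavierStokesRegularity.Theorems

end
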